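import Summits.QuantumFields.BalabanUV.Beta.RemainderExplicitHistoryDiagonalSource

/-!
# RemainderExplicitHistoryDiagonalSourceEverywhere — ROAD P3, ORDER-0 PROFILE FAMILY: THE WINDOW SOURCE PRICED AT EVERY POSITION BY ONE
# EXACT WEIGHT — for a box run of `K + n` steps the extra-history source over a window `[j₀, K)` is, both ways,
# `Σ_{j∈[j₀,K)} E_j ≍ (K·√(K−j₀))⁻¹ · Σ_a ρ(a)·min(a,K)·(min(a,K) − j₀)₊` (constants `4κ∕√b` above, `1∕(8κ₂√b₂)` below): a missing age `a` is
# felt at the `(min(a,K) − j₀)₊` window positions ultraviolet of `min(a,K)`, where an age-`a` coupling gap costs `min(a,K)∕(K√(K−j₀))` — young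
# ages `a ≪ K` cost `a∕K^{3∕2}` per position, old ones the coupling `≍ 1∕√(K−j₀)`.  At `j₀ = 0` this is generation 48's `min(a,K)²∕(K√K)` law
# (`…DiagonalSource`); in the infrared half it is below generation 49's `√(K−j₀)·(tail beyond j₀)`; in the ultraviolet half `0 < j₀ < K∕2` it is
# NEW (first file of station S-d4p3-g52-1 «the law at every position»; the second file derives the lower law for the matched discrepancy at
# every position and every cutoff, and the upper law modulo the ultraviolet feedback)

Cell `pub-balaban`, β-function sub-cell, BINDER row D4 «RemainderConst leaves for Bałaban's split» (`HOME/BINDER-OWNERS.md`; owner lineage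
`b2b-balaban-beta-an4`; this file by co-owner #3 lineage `b2b-balaban-beta-d4-p3`, road P3 «the reduction road», generation 52, station
S-d4p3-g52-1, first file; imports generation 48's `RemainderExplicitHistoryDiagonalSource`), β-FLOW TEAM duty (1); FREEZE (0) honoured
(def-free module in road P3's own `RemainderExplicit*` series; no leaf, no interface, no Literature file).  SOURCE OF THE SHAPES ONLY:
[Balaban1987RG1] (0.20) p. 256, (0.31) and Thm 2 p. 259, §5 p. 298.  [folklore] real analysis about ONE explicit toy family (ours), road P3's
ORDER-0 PROFILE FAMILY `β_{k+1} = b + Σ_{i≤k} ρ(k−i)·min(g_k, |g_k − g_i|)` (generation 44), memory PROFILE `ρ ≥ 0` summable (`Σ_{a<N} ρ_a ≤ W`).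
HONEST FRAMING: *"Discharging BetaPertH makes Bałaban's UV stability UNCONDITIONAL — a real constructive-QFT result; it is NOT the continuum
limit and NOT the Clay problem."*  THIS FILE DISCHARGES NOTHING OF THE KIND; nothing of Bałaban's (1.22) is asserted or constructed; row D4
class UNCHANGED (critical-path width 0; instance 0∕1; D4 DISCHARGE NO DATE); NOT B12 Thm 2, NOT BetaPertH, NOT continuum, NOT Clay.  HONEST
DEPENDENCY: continuum YM on T⁴ ⇐ BetaPertH ∧ nine spine estimates (0/9 proved); BetaPertH ⇐ (D1) ∧ (D4) ∧ CAP+tail; G-an2-4 gates asym, D1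
and NE2/3/4.  ABSOLUTE RULE: nothing is cited as a fact.  All letters NOT-IN-PRINT; `BetaFlowAsPrinted S` records a Markov β_n only.
QUESTION (generation 51's census OPEN (iii′)): the two-sided law for `d_{j₀}` is known at `j₀ = 0` (generation 48) and in the infrared half
(generations 49–51); everywhere else only the infrared-half majorant, loose by orders of magnitude in the deep ultraviolet.  NUMERICS of this
seat: `d_{j₀} ∕ Σ_{a>j₀} ρ(a)ω(a;j₀,K) ∈ [0.31, 1.04]` over ALL positions for power, flat, two-age, geometric and short profiles
(`HOME/b2b-balaban-beta-d4-p3/g52/numerics/everywhere_shape.out`), `ω(a; j₀, K) = min(a,K)·(min(a,K) − j₀)₊ ∕ (K·√(K − j₀))`.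

WHAT IS PROVED ([folklore]; 0 sorry; 0 `def`; §1 abstract `κ, κ₂ ≥ 1`; §3 one box run `g` of `K + n` steps, `κ = (b+Wγ)∕b`, `b₂ = 1∕(g_{K+n})² + b
+ Wγ`, `κ₂ = b₂∕b` as in `…DiagonalSource`).  §1 `sum_inv_sqrt_Ico_le` (`Σ_{j∈[j₀,m)} (b(K−j))^{−1∕2} ≤ 2(m−j₀)∕√(b(K−j₀))`);
**`windowFrom_upper_le`** (`Σ_{j∈[j₀,min(a,K))} (b(K−j))^{−1∕2}·min(1, κa∕(2(K−j))) ≤ 4κ·ω(a;j₀,K)∕√b`); **`le_windowFrom_lower`** (`ω(a;j₀,K)∕(κ₂√b₂) ≤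
Σ_{j∈[j₀,min(a,K))} (b₂(K−j))^{−1∕2}·min(1, a∕(κ₂(K−j)))`); `weightFrom_le_sqrt` (`ω(a;j₀,K) ≤ √(K−j₀)`: the infrared-half shape dominates).  §2
`sum_extra_ages_swap_Ico`, `filter_extra_Ico_subset ∕ _eq`, `srcFrom_eq_sum_ages`.  §3 **`srcFrom_le`** (`Σ_{j∈[j₀,K)} Σ_{i<n} ρ(j+n−i)(g_{j+n} − g_i)
≤ (4κ∕(K√(b(K−j₀))))·Σ_{a<K+n} ρ(a)min(a,K)(min(a,K)−j₀)₊`), **`le_srcFrom`** (`(1∕(8κ₂K√(b₂(K−j₀))))·Σ_{a<N} ρ(a)min(a,K)(min(a,K)−j₀)₊ ≤ …` for every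
`N ≤ j₀ + n + 1`).
-/

noncomputable section

open Finset

namespace Summit.QuantumFields.BalabanUV.Beta.RemainderExplicitHistoryDiagonalSourceEverywhere

open Literature.MathematicalPhysics.QuantumFieldTheory.Balaban1983to89
open Literature.MathematicalPhysics.QuantumFieldTheory.Balaban1983to89.FlowStep
open Literature.MathematicalPhysics.QuantumFieldTheory.Balaban1983to89.T4CouplingMatching
open Summit.QuantumFields.BalabanUV.Beta.RemainderExplicitHistoryDiagonalWeights
open Summit.QuantumFields.BalabanUV.Beta.RemainderExplicitHistoryDiagonalSource

variable {β : HBeta} {b γ W : ℝ} {ρ : ℕ → ℝ}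

/-! ## §1 Window sums from a position `j₀`: the exact weight of one missing age, both ways -/

/-- `Σ_{j∈[j₀,m)} 1∕√(b(K−j)) ≤ 2(m − j₀)∕√(b(K − j₀))` for `j₀ ≤ m ≤ K`, `j₀ < K` (each term is `≤ (2∕√b)(√(K−j) − √(K−j−1))`; the telescoped
`√(K−j₀) − √(K−m)` is `≤ (m−j₀)∕√(K−j₀)`). [folklore] -/
theorem sum_inv_sqrt_Ico_le {b : ℝ} (hb : 0 < b) {j₀ m K : ℕ} (hj₀m : j₀ ≤ m) (hmK : m ≤ K) (hj₀K : j₀ < K) :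
    ∑ j ∈ Ico j₀ m, 1 / Real.sqrt (b * ((K - j : ℕ) : ℝ))
      ≤ 2 * ((m - j₀ : ℕ) : ℝ) / Real.sqrt (b * ((K - j₀ : ℕ) : ℝ)) := by
  have hsb : 0 < Real.sqrt b := Real.sqrt_pos.2 hb
  set F : ℕ → ℝ := fun j => Real.sqrt ((K - j : ℕ) : ℝ) with hF
  have hterm : ∀ j ∈ Ico j₀ m, 1 / Real.sqrt (b * ((K - j : ℕ) : ℝ)) ≤ 2 / Real.sqrt b * (F j - F (j + 1)) := by
    intro j hj
    have hj' := Finset.mem_Ico.mp hj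
    have hjK : j < K := lt_of_lt_of_le hj'.2 hmK
    have hs : ((K - j : ℕ) : ℝ) = ((K - (j + 1) : ℕ) : ℝ) + 1 := by
      rw [show K - j = K - (j + 1) + 1 by omega]; push_cast; ring
    have hu0 : 0 < F j := Real.sqrt_pos.2 (by exact_mod_cast (show 0 < K - j by omega))
    have hv0 : 0 ≤ F (j + 1) := Real.sqrt_nonneg _
    have huv : F j ^ 2 - F (j + 1) ^ 2 = 1 := by
      simp only [hF]
      rw [Real.sq_sqrt (Nat.cast_nonneg _), Real.sq_sqrt (Nat.cast_nonneg _), hs]; ring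
    have hvu : F (j + 1) ≤ F j := by nlinarith
    rw [Real.sqrt_mul hb.le, div_le_iff₀ (mul_pos hsb hu0)]
    have e : 2 / Real.sqrt b * (F j - F (j + 1)) * (Real.sqrt b * F j) = 2 * (F j * (F j - F (j + 1))) := by
      field_simp
    rw [e]
    nlinarith [mul_nonneg hv0 (sub_nonneg.2 hvu)]
  have htel : ∑ j ∈ Ico j₀ m, (F j - F (j + 1)) = F j₀ - F m := by
    rw [Finset.sum_Ico_eq_sum_range]
    have := Finset.sum_range_sub' (fun t => F (j₀ + t)) (m - j₀)
    simp only [Nat.add_zero] at this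
    rw [show j₀ + (m - j₀) = m by omega] at this
    rw [← this]
    exact Finset.sum_congr rfl fun t _ => by rw [Nat.add_assoc]
  have h1 : ∑ j ∈ Ico j₀ m, 1 / Real.sqrt (b * ((K - j : ℕ) : ℝ)) ≤ 2 / Real.sqrt b * (F j₀ - F m) := by
    calc _ ≤ ∑ j ∈ Ico j₀ m, 2 / Real.sqrt b * (F j - F (j + 1)) := Finset.sum_le_sum hterm
      _ = 2 / Real.sqrt b * (F j₀ - F m) := by rw [← Finset.mul_sum, htel]
  have hU0 : 0 < F j₀ := Real.sqrt_pos.2 (by exact_mod_cast (show 0 < K - j₀ by omega))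
  have hV0 : 0 ≤ F m := Real.sqrt_nonneg _
  have hVU : F m ≤ F j₀ := Real.sqrt_le_sqrt (by exact_mod_cast (show K - m ≤ K - j₀ by omega))
  have hsq : F j₀ ^ 2 - F m ^ 2 = ((m - j₀ : ℕ) : ℝ) := by
    simp only [hF]
    rw [Real.sq_sqrt (Nat.cast_nonneg _), Real.sq_sqrt (Nat.cast_nonneg _)]
    rw [show ((m - j₀ : ℕ) : ℝ) = (m : ℝ) - j₀ by rw [Nat.cast_sub hj₀m], Nat.cast_sub (show j₀ ≤ K by omega),
      Nat.cast_sub hmK]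
    ring
  have h2 : F j₀ - F m ≤ ((m - j₀ : ℕ) : ℝ) / F j₀ := by
    rw [le_div_iff₀ hU0]
    nlinarith [mul_nonneg hV0 (sub_nonneg.2 hVU)]
  calc ∑ j ∈ Ico j₀ m, 1 / Real.sqrt (b * ((K - j : ℕ) : ℝ))
      ≤ 2 / Real.sqrt b * (F j₀ - F m) := h1
    _ ≤ 2 / Real.sqrt b * (((m - j₀ : ℕ) : ℝ) / F j₀) := mul_le_mul_of_nonneg_left h2 (by positivity)
    _ = 2 * ((m - j₀ : ℕ) : ℝ) / Real.sqrt (b * ((K - j₀ : ℕ) : ℝ)) := by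
        rw [Real.sqrt_mul hb.le]
        simp only [hF]
        field_simp

/-- **THE UPPER WINDOW SUM FROM A POSITION.**  For `b > 0`, `κ ≥ 1`, `j₀ < K` and an age `a`:
`Σ_{j∈[j₀,min(a,K))} (1∕√(b(K−j)))·min(1, κa∕(2(K−j))) ≤ 4κ·min(a,K)·(min(a,K) − j₀)₊ ∕ (K·√(b(K−j₀)))` — a young age `a ≤ K∕2` is missing at
`(a − j₀)₊` window positions, all at infrared distance `≥ K∕2`, where each costs `≤ √2κa∕(K√(bK))`; an older age pays the profile sum
`Σ_{j∈[j₀,min(a,K))} (b(K−j))^{−1∕2} ≤ 2(min(a,K)−j₀)∕√(b(K−j₀))` and `K < 2min(a,K)`. [folklore] -/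
theorem windowFrom_upper_le {b κ : ℝ} (hb : 0 < b) (hκ : 1 ≤ κ) {j₀ K : ℕ} (hj₀K : j₀ < K) (a : ℕ) :
    ∑ j ∈ Ico j₀ (min a K), 1 / Real.sqrt (b * ((K - j : ℕ) : ℝ)) * min 1 (κ * a / (2 * ((K - j : ℕ) : ℝ)))
      ≤ 4 * κ * ((min (a : ℝ) K) * ((min a K - j₀ : ℕ) : ℝ)) / ((K : ℝ) * Real.sqrt (b * ((K - j₀ : ℕ) : ℝ))) := by
  have hKpos : (0 : ℝ) < K := by exact_mod_cast (show 0 < K by omega)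
  have hs0pos : (0 : ℝ) < ((K - j₀ : ℕ) : ℝ) := by exact_mod_cast (show 0 < K - j₀ by omega)
  have hsbK0 : 0 < Real.sqrt (b * ((K - j₀ : ℕ) : ℝ)) := Real.sqrt_pos.2 (by positivity)
  have hsbK : 0 < Real.sqrt (b * K) := Real.sqrt_pos.2 (by positivity)
  have hmin0 : 0 ≤ min (a : ℝ) K := le_min (Nat.cast_nonneg a) hKpos.le
  by_cases hmj : min a K ≤ j₀
  · rw [Finset.Ico_eq_empty_of_le hmj, Finset.sum_empty, show min a K - j₀ = 0 by omega]; simp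
  rw [not_le] at hmj
  have hterm1 : ∀ j ∈ Ico j₀ (min a K), 1 / Real.sqrt (b * ((K - j : ℕ) : ℝ)) * min 1 (κ * a / (2 * ((K - j : ℕ) : ℝ)))
      ≤ 1 / Real.sqrt (b * ((K - j : ℕ) : ℝ)) := by
    intro j _; exact mul_le_of_le_one_right (by positivity) (min_le_left _ _)
  have hKj₀ : 1 / Real.sqrt (b * K) ≤ 1 / Real.sqrt (b * ((K - j₀ : ℕ) : ℝ)) :=
    one_div_le_one_div_of_le hsbK0 (Real.sqrt_le_sqrt (by
      have : ((K - j₀ : ℕ) : ℝ) ≤ K := by exact_mod_cast Nat.sub_le K j₀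
      nlinarith))
  by_cases h2a : 2 * a ≤ K
  · have haK : min a K = a := min_eq_left (by omega)
    have hmin : min (a : ℝ) K = a := by rw [min_eq_left]; exact_mod_cast (by omega : a ≤ K)
    rw [haK] at hmj ⊢
    rw [hmin]
    have hterm2 : ∀ j ∈ Ico j₀ a, 1 / Real.sqrt (b * ((K - j : ℕ) : ℝ)) * min 1 (κ * a / (2 * ((K - j : ℕ) : ℝ)))
        ≤ Real.sqrt 2 * κ * a / ((K : ℝ) * Real.sqrt (b * K)) := by
      intro j hj
      have hj' := (Finset.mem_Ico.mp hj).2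
      have hs : (K : ℝ) ≤ 2 * ((K - j : ℕ) : ℝ) := by
        rw [Nat.cast_sub (by omega)]
        have : (2 : ℝ) * a ≤ K := by exact_mod_cast h2a
        have : (j : ℝ) < a := by exact_mod_cast hj'
        linarith
      have hs0 : (0 : ℝ) < ((K - j : ℕ) : ℝ) := by linarith
      have h1 : 1 / Real.sqrt (b * ((K - j : ℕ) : ℝ)) ≤ Real.sqrt 2 / Real.sqrt (b * K) := by
        rw [div_le_div_iff₀ (Real.sqrt_pos.2 (by positivity)) hsbK, one_mul, ← Real.sqrt_mul (by norm_num : (0:ℝ) ≤ 2)]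
        exact Real.sqrt_le_sqrt (by nlinarith [hb])
      have h2 : min 1 (κ * a / (2 * ((K - j : ℕ) : ℝ))) ≤ κ * a / K :=
        (min_le_right _ _).trans (div_le_div_of_nonneg_left (by positivity) hKpos hs)
      calc 1 / Real.sqrt (b * ((K - j : ℕ) : ℝ)) * min 1 (κ * a / (2 * ((K - j : ℕ) : ℝ)))
          ≤ Real.sqrt 2 / Real.sqrt (b * K) * (κ * a / K) :=
            mul_le_mul h1 h2 (le_min zero_le_one (by positivity)) (by positivity)
        _ = Real.sqrt 2 * κ * a / ((K : ℝ) * Real.sqrt (b * K)) := by field_simp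
    have hs2 : Real.sqrt 2 ≤ 2 := by
      rw [show (2:ℝ) = Real.sqrt 4 by rw [show (4:ℝ) = 2 ^ 2 by norm_num, Real.sqrt_sq (by norm_num)]]
      exact Real.sqrt_le_sqrt (by norm_num)
    calc ∑ j ∈ Ico j₀ a, 1 / Real.sqrt (b * ((K - j : ℕ) : ℝ)) * min 1 (κ * a / (2 * ((K - j : ℕ) : ℝ)))
        ≤ ∑ j ∈ Ico j₀ a, Real.sqrt 2 * κ * a / ((K : ℝ) * Real.sqrt (b * K)) := Finset.sum_le_sum hterm2
      _ = Real.sqrt 2 * κ * ((a : ℝ) * ((a - j₀ : ℕ) : ℝ)) * (1 / K) * (1 / Real.sqrt (b * K)) := by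
          rw [Finset.sum_const, Nat.card_Ico, nsmul_eq_mul]; field_simp
      _ ≤ 4 * κ * ((a : ℝ) * ((a - j₀ : ℕ) : ℝ)) * (1 / K) * (1 / Real.sqrt (b * ((K - j₀ : ℕ) : ℝ))) := by
          have hA : 0 ≤ κ * ((a : ℝ) * ((a - j₀ : ℕ) : ℝ)) * (1 / K) := by positivity
          exact mul_le_mul (by nlinarith) hKj₀ (by positivity) (by positivity)
      _ = 4 * κ * ((a : ℝ) * ((a - j₀ : ℕ) : ℝ)) / ((K : ℝ) * Real.sqrt (b * ((K - j₀ : ℕ) : ℝ))) := by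
          field_simp
  · rw [not_le] at h2a
    have hmK : min a K ≤ K := min_le_right a K
    have hmin2 : (K : ℝ) ≤ 2 * min (a : ℝ) K := by
      rcases le_total (a : ℝ) K with h | h
      · rw [min_eq_left h]; exact_mod_cast (by omega : K ≤ 2 * a)
      · rw [min_eq_right h]; linarith
    calc ∑ j ∈ Ico j₀ (min a K), 1 / Real.sqrt (b * ((K - j : ℕ) : ℝ)) * min 1 (κ * a / (2 * ((K - j : ℕ) : ℝ)))
        ≤ ∑ j ∈ Ico j₀ (min a K), 1 / Real.sqrt (b * ((K - j : ℕ) : ℝ)) := Finset.sum_le_sum hterm1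
      _ ≤ 2 * ((min a K - j₀ : ℕ) : ℝ) / Real.sqrt (b * ((K - j₀ : ℕ) : ℝ)) :=
          sum_inv_sqrt_Ico_le hb hmj.le hmK hj₀K
      _ = 2 * ((min a K - j₀ : ℕ) : ℝ) * K / ((K : ℝ) * Real.sqrt (b * ((K - j₀ : ℕ) : ℝ))) := by
          field_simp
      _ ≤ 4 * κ * ((min (a : ℝ) K) * ((min a K - j₀ : ℕ) : ℝ)) / ((K : ℝ) * Real.sqrt (b * ((K - j₀ : ℕ) : ℝ))) := by
          refine div_le_div_of_nonneg_right ?_ (by positivity)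
          have h0 : (0 : ℝ) ≤ ((min a K - j₀ : ℕ) : ℝ) := Nat.cast_nonneg _
          nlinarith [mul_nonneg h0 (sub_nonneg.2 hmin2), mul_nonneg (mul_nonneg h0 hmin0) (sub_nonneg.2 hκ)]

/-- **THE LOWER WINDOW SUM FROM A POSITION.**  For `b₂ > 0`, `κ₂ ≥ 1`, `j₀ < K` and an age `a`:
`min(a,K)·(min(a,K) − j₀)₊ ∕ (κ₂·K·√(b₂(K−j₀))) ≤ Σ_{j∈[j₀,min(a,K))} (1∕√(b₂(K−j)))·min(1, a∕(κ₂(K−j)))` — each of the `(min(a,K) − j₀)₊` terms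
is at least the one at the window's largest infrared distance `K − j₀`, which is `≥ (1∕√(b₂(K−j₀)))·min(a,K)∕(κ₂K)`. [folklore] -/
theorem le_windowFrom_lower {b₂ κ₂ : ℝ} (hb₂ : 0 < b₂) (hκ₂ : 1 ≤ κ₂) {j₀ K : ℕ} (hj₀K : j₀ < K) (a : ℕ) :
    (min (a : ℝ) K) * ((min a K - j₀ : ℕ) : ℝ) / (κ₂ * K * Real.sqrt (b₂ * ((K - j₀ : ℕ) : ℝ)))
      ≤ ∑ j ∈ Ico j₀ (min a K), 1 / Real.sqrt (b₂ * ((K - j : ℕ) : ℝ)) * min 1 (a / (κ₂ * ((K - j : ℕ) : ℝ))) := by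
  have hKpos : (0 : ℝ) < K := by exact_mod_cast (show 0 < K by omega)
  have hs0pos : (0 : ℝ) < ((K - j₀ : ℕ) : ℝ) := by exact_mod_cast (show 0 < K - j₀ by omega)
  have hsbK0 : 0 < Real.sqrt (b₂ * ((K - j₀ : ℕ) : ℝ)) := Real.sqrt_pos.2 (by positivity)
  have hmin0 : 0 ≤ min (a : ℝ) K := le_min (Nat.cast_nonneg a) hKpos.le
  have hminK : min (a : ℝ) K ≤ K := min_le_right _ _
  have hmina : min (a : ℝ) K ≤ a := min_le_left _ _
  by_cases hmj : min a K ≤ j₀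
  · rw [Finset.Ico_eq_empty_of_le hmj, Finset.sum_empty, show min a K - j₀ = 0 by omega]; simp
  rw [not_le] at hmj
  have hterm : ∀ j ∈ Ico j₀ (min a K), 1 / Real.sqrt (b₂ * ((K - j₀ : ℕ) : ℝ)) * (min (a : ℝ) K / (κ₂ * K))
      ≤ 1 / Real.sqrt (b₂ * ((K - j : ℕ) : ℝ)) * min 1 (a / (κ₂ * ((K - j : ℕ) : ℝ))) := by
    intro j hj
    have hj' := Finset.mem_Ico.mp hj
    have hjK : j < K := lt_of_lt_of_le hj'.2 (min_le_right a K)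
    have hs1 : (0 : ℝ) < ((K - j : ℕ) : ℝ) := by exact_mod_cast (by omega : 0 < K - j)
    have hsK : ((K - j : ℕ) : ℝ) ≤ K := by exact_mod_cast Nat.sub_le K j
    have hss : ((K - j : ℕ) : ℝ) ≤ ((K - j₀ : ℕ) : ℝ) := by exact_mod_cast (show K - j ≤ K - j₀ by omega)
    have h1 : 1 / Real.sqrt (b₂ * ((K - j₀ : ℕ) : ℝ)) ≤ 1 / Real.sqrt (b₂ * ((K - j : ℕ) : ℝ)) :=
      one_div_le_one_div_of_le (Real.sqrt_pos.2 (by positivity)) (Real.sqrt_le_sqrt (by nlinarith))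
    have h2 : min (a : ℝ) K / (κ₂ * K) ≤ min 1 (a / (κ₂ * ((K - j : ℕ) : ℝ))) := by
      refine le_min ?_ ?_
      · rw [div_le_one (by positivity)]; nlinarith
      · exact div_le_div₀ (Nat.cast_nonneg a) hmina (by positivity) (by nlinarith)
    exact mul_le_mul h1 h2 (by positivity) (by positivity)
  calc (min (a : ℝ) K) * ((min a K - j₀ : ℕ) : ℝ) / (κ₂ * K * Real.sqrt (b₂ * ((K - j₀ : ℕ) : ℝ)))
      = ((min a K - j₀ : ℕ) : ℝ) * (1 / Real.sqrt (b₂ * ((K - j₀ : ℕ) : ℝ)) * (min (a : ℝ) K / (κ₂ * K))) := by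
        field_simp
    _ = ∑ j ∈ Ico j₀ (min a K), 1 / Real.sqrt (b₂ * ((K - j₀ : ℕ) : ℝ)) * (min (a : ℝ) K / (κ₂ * K)) := by
        rw [Finset.sum_const, Nat.card_Ico, nsmul_eq_mul]
    _ ≤ _ := Finset.sum_le_sum hterm

/-- THE NEW WEIGHT SITS BELOW THE INFRARED-HALF SHAPE: `min(a,K)·(min(a,K) − j₀)₊ ∕ (K·√(K−j₀)) ≤ √(K − j₀)` for `j₀ < K` (and the weight is `0`
for `a ≤ j₀`) — so an upper bound by `Σ_a ρ(a)·ω(a;j₀,K)` implies generations 49–51's bound by `√(K−j₀)·(tail of ρ beyond j₀)`, and is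
sharper exactly for the young missing ages `j₀ < a ≪ K`. [folklore] -/
theorem weightFrom_le_sqrt {j₀ K : ℕ} (hj₀K : j₀ < K) (a : ℕ) :
    (min (a : ℝ) K) * ((min a K - j₀ : ℕ) : ℝ) / ((K : ℝ) * Real.sqrt ((K - j₀ : ℕ) : ℝ))
      ≤ Real.sqrt ((K - j₀ : ℕ) : ℝ) := by
  have hKpos : (0 : ℝ) < K := by exact_mod_cast (show 0 < K by omega)
  have hs0pos : (0 : ℝ) < ((K - j₀ : ℕ) : ℝ) := by exact_mod_cast (show 0 < K - j₀ by omega)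
  have hmin0 : 0 ≤ min (a : ℝ) K := le_min (Nat.cast_nonneg a) hKpos.le
  have hminK : min (a : ℝ) K ≤ K := min_le_right _ _
  have hd : ((min a K - j₀ : ℕ) : ℝ) ≤ ((K - j₀ : ℕ) : ℝ) := by
    exact_mod_cast (show min a K - j₀ ≤ K - j₀ from Nat.sub_le_sub_right (min_le_right a K) j₀)
  have hd0 : (0 : ℝ) ≤ ((min a K - j₀ : ℕ) : ℝ) := Nat.cast_nonneg _
  rw [div_le_iff₀ (by positivity)]
  have hSS : Real.sqrt ((K - j₀ : ℕ) : ℝ) * Real.sqrt ((K - j₀ : ℕ) : ℝ) = ((K - j₀ : ℕ) : ℝ) := Real.mul_self_sqrt hs0pos.le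
  calc min (a : ℝ) K * ((min a K - j₀ : ℕ) : ℝ) ≤ (K : ℝ) * ((K - j₀ : ℕ) : ℝ) :=
        mul_le_mul hminK hd hd0 hKpos.le
    _ = Real.sqrt ((K - j₀ : ℕ) : ℝ) * ((K : ℝ) * Real.sqrt ((K - j₀ : ℕ) : ℝ)) := by
        rw [mul_comm (K : ℝ) (Real.sqrt _), ← mul_assoc, hSS, mul_comm]

/-! ## §2 The age-major form of the source over a window `[j₀, K)` -/

/-- POSITION-MAJOR TO AGE-MAJOR OVER A WINDOW: for any `F : ℕ → ℕ → ℝ`,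
`Σ_{j∈[j₀,K)} Σ_{i<n} F (j+n−i) j = Σ_{a<K+n} Σ_{j∈[j₀,K), j+1 ≤ a ≤ j+n} F a j` (`…Weights.sum_extra_ages_swap` is `j₀ = 0`). [folklore] -/
theorem sum_extra_ages_swap_Ico (F : ℕ → ℕ → ℝ) (j₀ K n : ℕ) :
    ∑ j ∈ Ico j₀ K, ∑ i ∈ range n, F (j + n - i) j
      = ∑ a ∈ range (K + n), ∑ j ∈ (Ico j₀ K).filter (fun j => j + 1 ≤ a ∧ a ≤ j + n), F a j := by
  classical
  have hinner : ∀ j ∈ Ico j₀ K, ∑ i ∈ range n, F (j + n - i) j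
      = ∑ a ∈ range (K + n), if j + 1 ≤ a ∧ a ≤ j + n then F a j else 0 := by
    intro j hj
    have hjK := (Finset.mem_Ico.mp hj).2
    have hset : (range (K + n)).filter (fun a => j + 1 ≤ a ∧ a ≤ j + n) = Ico (j + 1) (j + n + 1) := by
      ext a
      simp only [Finset.mem_filter, Finset.mem_range, Finset.mem_Ico]
      omega
    rw [← Finset.sum_filter, hset, Finset.sum_Ico_eq_sum_range, show j + n + 1 - (j + 1) = n by omega,
      ← Finset.sum_range_reflect (fun i => F (j + n - i) j) n]
    refine Finset.sum_congr rfl fun i hi => ?_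
    have hi' := Finset.mem_range.mp hi
    rw [show j + n - (n - 1 - i) = j + 1 + i by omega]
  rw [Finset.sum_congr rfl hinner, Finset.sum_comm]
  refine Finset.sum_congr rfl fun a _ => ?_
  rw [Finset.sum_filter]

/-- The window positions carrying an extra age `a` lie in `[j₀, min(a,K))` … [folklore] -/
theorem filter_extra_Ico_subset (j₀ K n a : ℕ) :
    (Ico j₀ K).filter (fun j => j + 1 ≤ a ∧ a ≤ j + n) ⊆ Ico j₀ (min a K) := by
  intro j hj
  simp only [Finset.mem_filter, Finset.mem_Ico] at hj
  simp only [Finset.mem_Ico, lt_min_iff]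
  omega

/-- … and fill it when `a ≤ j₀ + n`. [folklore] -/
theorem filter_extra_Ico_eq {j₀ K n a : ℕ} (ha : a ≤ j₀ + n) :
    (Ico j₀ K).filter (fun j => j + 1 ≤ a ∧ a ≤ j + n) = Ico j₀ (min a K) := by
  ext j
  simp only [Finset.mem_filter, Finset.mem_Ico, lt_min_iff]
  omega

/-- Re-indexing the window source by age:
`Σ_{j∈[j₀,K)} Σ_{i<n} ρ(j+n−i)·(g_{j+n} − g_i) = Σ_{a<K+n} Σ_{j∈[j₀,K), j+1≤a≤j+n} ρ(a)·(g_{j+n} − g_{j+n−a})`. [folklore] -/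
theorem srcFrom_eq_sum_ages (g : ℕ → ℝ) (j₀ K n : ℕ) :
    ∑ j ∈ Ico j₀ K, ∑ i ∈ range n, ρ (j + n - i) * (g (j + n) - g i)
      = ∑ a ∈ range (K + n), ∑ j ∈ (Ico j₀ K).filter (fun j => j + 1 ≤ a ∧ a ≤ j + n),
          ρ a * (g (j + n) - g (j + n - a)) := by
  rw [← sum_extra_ages_swap_Ico (fun a j => ρ a * (g (j + n) - g (j + n - a))) j₀ K n]
  refine Finset.sum_congr rfl fun j _ => Finset.sum_congr rfl fun i hi => ?_
  have hi' := Finset.mem_range.mp hi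
  rw [show j + n - (j + n - i) = i by omega]

/-! ## §3 The window source at every position, both ways -/

/-- **THE WINDOW SOURCE FROM ABOVE, AT EVERY POSITION.**  On a box run `g` of `K + n` steps of the order-0 profile family (`b > 0`, `γ > 0`,
`ρ ≥ 0`, `Σ_{a<N} ρ_a ≤ W`), for every `j₀ < K`:
`Σ_{j∈[j₀,K)} Σ_{i<n} ρ(j+n−i)·(g_{j+n} − g_i) ≤ (4κ ∕ (K√(b(K−j₀))))·Σ_{a<K+n} ρ(a)·min(a,K)·(min(a,K) − j₀)₊`, `κ = (b + Wγ)∕b`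
(`…DiagonalSource.gap_le_profile_min` per position, `windowFrom_upper_le` per age).  At `j₀ = 0` this is generation 48's `src_le` (constant `4κ`
for `8κ`). [cite: Balaban1987RG1, (0.31) p.259] -/
theorem srcFrom_le
    (hβ : ∀ (k : ℕ) (p : Fin (k + 1) → ℝ),
      β k p = b + ∑ i : Fin (k + 1), ρ (k - i) * min (p (Fin.last k)) (|p (Fin.last k) - p i|))
    (hb : 0 < b) (hγ : 0 < γ) (hρ0 : ∀ a, 0 ≤ ρ a) (hρW : ∀ n, ∑ a ∈ range n, ρ a ≤ W) {K n : ℕ} {g : ℕ → ℝ}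
    (h : RGEqH (K + n) β g) (hbox : ∀ k, k ≤ K + n → 0 < g k ∧ g k ≤ γ) {j₀ : ℕ} (hj₀K : j₀ < K) :
    ∑ j ∈ Ico j₀ K, ∑ i ∈ range n, ρ (j + n - i) * (g (j + n) - g i)
      ≤ 4 * ((b + W * γ) / b) / ((K : ℝ) * Real.sqrt (b * ((K - j₀ : ℕ) : ℝ)))
          * ∑ a ∈ range (K + n), ρ a * ((min (a : ℝ) K) * ((min a K - j₀ : ℕ) : ℝ)) := by
  have hW : 0 ≤ W := by simpa using hρW 0
  have hκ : 1 ≤ (b + W * γ) / b := by rw [le_div_iff₀ hb]; nlinarith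
  have hKpos : (0 : ℝ) < K := by exact_mod_cast (show 0 < K by omega)
  rw [srcFrom_eq_sum_ages g j₀ K n, Finset.mul_sum]
  refine Finset.sum_le_sum fun a _ => ?_
  have hwin := windowFrom_upper_le hb hκ hj₀K a
  calc ∑ j ∈ (Ico j₀ K).filter (fun j => j + 1 ≤ a ∧ a ≤ j + n), ρ a * (g (j + n) - g (j + n - a))
      ≤ ∑ j ∈ (Ico j₀ K).filter (fun j => j + 1 ≤ a ∧ a ≤ j + n),
          ρ a * (1 / Real.sqrt (b * ((K - j : ℕ) : ℝ)) * min 1 ((b + W * γ) / b * a / (2 * ((K - j : ℕ) : ℝ)))) := by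
        refine Finset.sum_le_sum fun j hj => mul_le_mul_of_nonneg_left ?_ (hρ0 a)
        have hj' := Finset.mem_filter.mp hj
        exact gap_le_profile_min hβ hb hγ hρ0 hρW h hbox (Finset.mem_Ico.mp hj'.1).2 (by omega)
    _ ≤ ∑ j ∈ Ico j₀ (min a K),
          ρ a * (1 / Real.sqrt (b * ((K - j : ℕ) : ℝ)) * min 1 ((b + W * γ) / b * a / (2 * ((K - j : ℕ) : ℝ)))) := by
        refine Finset.sum_le_sum_of_subset_of_nonneg (filter_extra_Ico_subset j₀ K n a) fun j _ _ => ?_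
        exact mul_nonneg (hρ0 a) (mul_nonneg (by positivity) (le_min zero_le_one (by positivity)))
    _ = ρ a * ∑ j ∈ Ico j₀ (min a K),
          1 / Real.sqrt (b * ((K - j : ℕ) : ℝ)) * min 1 ((b + W * γ) / b * a / (2 * ((K - j : ℕ) : ℝ))) := by
        rw [Finset.mul_sum]
    _ ≤ ρ a * (4 * ((b + W * γ) / b) * ((min (a : ℝ) K) * ((min a K - j₀ : ℕ) : ℝ))
          / ((K : ℝ) * Real.sqrt (b * ((K - j₀ : ℕ) : ℝ)))) :=
        mul_le_mul_of_nonneg_left hwin (hρ0 a)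
    _ = 4 * ((b + W * γ) / b) / ((K : ℝ) * Real.sqrt (b * ((K - j₀ : ℕ) : ℝ)))
          * (ρ a * ((min (a : ℝ) K) * ((min a K - j₀ : ℕ) : ℝ))) := by ring

/-- **THE WINDOW SOURCE FROM BELOW, AT EVERY POSITION.**  Same run, `j₀ < K`; with `b₂ = 1∕(g_{K+n})² + (b + Wγ)`, `κ₂ = b₂∕b`, for every
`N ≤ j₀ + n + 1`:
`(1 ∕ (8κ₂·K√(b₂(K−j₀))))·Σ_{a<N} ρ(a)·min(a,K)·(min(a,K) − j₀)₊ ≤ Σ_{j∈[j₀,K)} Σ_{i<n} ρ(j+n−i)·(g_{j+n} − g_i)` — the ages `a ≤ j₀ + n` are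
missing at EVERY window position ultraviolet of `min(a,K)`, where asymptotic freedom from BELOW still separates the couplings
(`…DiagonalSource.profile_min_le_gap` per position, `le_windowFrom_lower` per age). [cite: Balaban1987RG1, (0.31) p.259] -/
theorem le_srcFrom
    (hβ : ∀ (k : ℕ) (p : Fin (k + 1) → ℝ),
      β k p = b + ∑ i : Fin (k + 1), ρ (k - i) * min (p (Fin.last k)) (|p (Fin.last k) - p i|))
    (hb : 0 < b) (hγ : 0 < γ) (hρ0 : ∀ a, 0 ≤ ρ a) (hρW : ∀ n, ∑ a ∈ range n, ρ a ≤ W) {K n : ℕ} {g : ℕ → ℝ}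
    (h : RGEqH (K + n) β g) (hbox : ∀ k, k ≤ K + n → 0 < g k ∧ g k ≤ γ) {j₀ : ℕ} (hj₀K : j₀ < K) {N : ℕ}
    (hN : N ≤ j₀ + n + 1) :
    1 / (8 * ((1 / (g (K + n)) ^ 2 + (b + W * γ)) / b * K
          * Real.sqrt ((1 / (g (K + n)) ^ 2 + (b + W * γ)) * ((K - j₀ : ℕ) : ℝ))))
        * ∑ a ∈ range N, ρ a * ((min (a : ℝ) K) * ((min a K - j₀ : ℕ) : ℝ))
      ≤ ∑ j ∈ Ico j₀ K, ∑ i ∈ range n, ρ (j + n - i) * (g (j + n) - g i) := by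
  have hW : 0 ≤ W := by simpa using hρW 0
  have hpinpos := (hbox (K + n) le_rfl).1
  set b₂ : ℝ := 1 / (g (K + n)) ^ 2 + (b + W * γ) with hb₂
  have hb₂pos : 0 < b₂ := by rw [hb₂]; positivity
  have hκ₂ : 1 ≤ b₂ / b := by
    rw [le_div_iff₀ hb, hb₂]
    have : 0 ≤ 1 / (g (K + n)) ^ 2 := by positivity
    nlinarith
  have hKpos : (0 : ℝ) < K := by exact_mod_cast (show 0 < K by omega)
  have hs0pos : (0 : ℝ) < ((K - j₀ : ℕ) : ℝ) := by exact_mod_cast (show 0 < K - j₀ by omega)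
  have hF0 : ∀ a ∈ range (K + n),
      0 ≤ ∑ j ∈ (Ico j₀ K).filter (fun j => j + 1 ≤ a ∧ a ≤ j + n), ρ a * (g (j + n) - g (j + n - a)) := by
    intro a _
    refine Finset.sum_nonneg fun j hj => mul_nonneg (hρ0 a) ?_
    have hj' := Finset.mem_filter.mp hj
    have := profile_min_le_gap hβ hb hγ hρ0 hρW h hbox (Finset.mem_Ico.mp hj'.1).2 (show a ≤ j + n by omega)
    exact le_trans (mul_nonneg (by positivity) (le_min zero_le_one (by positivity))) this
  have hNle : N ≤ K + n := by omega
  rw [srcFrom_eq_sum_ages g j₀ K n, Finset.mul_sum]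
  calc ∑ a ∈ range N, 1 / (8 * (b₂ / b * K * Real.sqrt (b₂ * ((K - j₀ : ℕ) : ℝ))))
          * (ρ a * ((min (a : ℝ) K) * ((min a K - j₀ : ℕ) : ℝ)))
      = ∑ a ∈ range N, ρ a / 8 * ((min (a : ℝ) K) * ((min a K - j₀ : ℕ) : ℝ)
          / (b₂ / b * K * Real.sqrt (b₂ * ((K - j₀ : ℕ) : ℝ)))) :=
        Finset.sum_congr rfl fun a _ => by ring
    _ ≤ ∑ a ∈ range N, ρ a / 8 * ∑ j ∈ Ico j₀ (min a K),
          1 / Real.sqrt (b₂ * ((K - j : ℕ) : ℝ)) * min 1 (a / (b₂ / b * ((K - j : ℕ) : ℝ))) :=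
        Finset.sum_le_sum fun a _ =>
          mul_le_mul_of_nonneg_left (le_windowFrom_lower hb₂pos hκ₂ hj₀K a) (by have := hρ0 a; positivity)
    _ = ∑ a ∈ range N, ∑ j ∈ Ico j₀ (min a K),
          ρ a * (1 / (8 * Real.sqrt (b₂ * ((K - j : ℕ) : ℝ))) * min 1 (a / (b₂ / b * ((K - j : ℕ) : ℝ)))) := by
        refine Finset.sum_congr rfl fun a _ => ?_
        rw [Finset.mul_sum]
        refine Finset.sum_congr rfl fun j _ => ?_
        rw [show 1 / (8 * Real.sqrt (b₂ * ((K - j : ℕ) : ℝ))) = 1 / Real.sqrt (b₂ * ((K - j : ℕ) : ℝ)) / 8 by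
          rw [mul_comm, ← div_div]]
        ring
    _ ≤ ∑ a ∈ range N, ∑ j ∈ Ico j₀ (min a K), ρ a * (g (j + n) - g (j + n - a)) := by
        refine Finset.sum_le_sum fun a ha => Finset.sum_le_sum fun j hj => mul_le_mul_of_nonneg_left ?_ (hρ0 a)
        have hj' := Finset.mem_Ico.mp hj
        have ha' := Finset.mem_range.mp ha
        have hjK : j < K := lt_of_lt_of_le hj'.2 (min_le_right a K)
        exact profile_min_le_gap hβ hb hγ hρ0 hρW h hbox hjK (by omega)
    _ = ∑ a ∈ range N, ∑ j ∈ (Ico j₀ K).filter (fun j => j + 1 ≤ a ∧ a ≤ j + n),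
          ρ a * (g (j + n) - g (j + n - a)) := by
        refine Finset.sum_congr rfl fun a ha => ?_
        rw [filter_extra_Ico_eq (by have := Finset.mem_range.mp ha; omega : a ≤ j₀ + n)]
    _ ≤ ∑ a ∈ range (K + n), ∑ j ∈ (Ico j₀ K).filter (fun j => j + 1 ≤ a ∧ a ≤ j + n),
          ρ a * (g (j + n) - g (j + n - a)) :=
        Finset.sum_le_sum_of_subset_of_nonneg (Finset.range_mono hNle) fun a ha _ => hF0 a ha

end Summit.QuantumFields.BalabanUV.Beta.RemainderExplicitHistoryDiagonalSourceEverywhere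

end
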